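import Summits.QuantumFields.YangMills.Theses.DirichletWindow

/-!
# Route DirichletWindow — the chord glue `XiDivergesOfFixedDistance`

Item `stmt-QuantumFields-8943` of route `route-QuantumFields-DirichletWindow` (shared verbatim with
route `XiCompleteMonotonicity`):

`AxialLogConvexity → FixedDistanceLower → PlaquetteVarianceUpper → XiDiverges`.

The proof is elementary real analysis.  Write `a k = f_β(k e₀)` for the axial plaquette–plaquette
covariance of a limit state `μ`.  `AxialLogConvexity` says that `a` is non-negative,
non-increasing and log-convex from index `1` on (`a (k+2)² ≤ a (k+1) · a (k+3)`).  Given `ε > 0`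
choose `n ≥ max n₀ 2` with `(log B' − log A + 8 log n)/(n − 1) < ε` (`B' = max B 1`), then
`β ≥ max β_n β₁ 1`.  For such `β` and every limit state, `a n ≥ A/(β² n⁸) > 0` and
`a 1 ≤ a 0 ≤ B'/β²`, so the chord slope `m := (log a 1 − log a n)/(n − 1)` satisfies
`0 ≤ m ≤ ε`, and log-convexity propagates the chord beyond `n`:
`a k ≥ a n · e^{−m (k − n)} ≥ a n · e^{−m k}` for `k ≥ n`, while `a k ≥ a n` for `k ≤ n` by
monotonicity.  Hence `XiDiverges` holds with rate `m` and amplitude `a n`.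
-/

namespace Summit.QuantumFields.YangMills.Theorems

open Real Filter Topology

/-- Chord inequality for a non-increasing real sequence `a` which is log-convex from index `1`
on (`a (k+2)^2 ≤ a (k+1) * a (k+3)` for all `k`) and positive at some index `n ≥ 2`: the chord
slope `m = (log (a 1) - log (a n)) / (n - 1)` is non-negative and `a n * exp (-(m * k)) ≤ a k`
for every `k`. -/
theorem xiChord_exp_lower (a : ℕ → ℝ) (n : ℕ) (hn : 2 ≤ n)
    (hmono : ∀ k, a (k + 1) ≤ a k) (hconv : ∀ k, a (k + 2) ^ 2 ≤ a (k + 1) * a (k + 3))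
    (hpos : 0 < a n) :
    0 ≤ (Real.log (a 1) - Real.log (a n)) / ((n : ℝ) - 1) ∧
      ∀ k : ℕ, a n * Real.exp (-((Real.log (a 1) - Real.log (a n)) / ((n : ℝ) - 1) * k)) ≤
        a k := by
  have hanti : Antitone a := antitone_nat_of_succ_le hmono
  obtain ⟨n', rfl⟩ : ∃ n', n = n' + 2 := ⟨n - 2, by omega⟩
  -- positivity of every term: below `n` by monotonicity, above `n` by log-convexity
  have hpos12 : ∀ j, 0 < a (j + 1) ∧ 0 < a (j + 2) := by
    intro j
    induction j with
    | zero => exact ⟨hpos.trans_le (hanti (by omega)), hpos.trans_le (hanti (by omega))⟩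
    | succ j ih =>
      refine ⟨ih.2, ?_⟩
      have h := hconv j
      have h2 : 0 < a (j + 2) ^ 2 := pow_pos ih.2 2
      have h3 : 0 < a (j + 1) * a (j + 3) := lt_of_lt_of_le h2 h
      rcases pos_and_pos_or_neg_and_neg_of_mul_pos h3 with h4 | h4
      · exact h4.2
      · exact absurd h4.1 (not_lt.mpr ih.1.le)
  have hposAll : ∀ k, 0 < a k := by
    intro k
    cases k with
    | zero => exact (hpos12 0).1.trans_le (hmono 0)
    | succ k => exact (hpos12 k).1
  -- the log-increments `d i = log a (i+2) - log a (i+1)` are non-decreasing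
  set d : ℕ → ℝ := fun i => Real.log (a (i + 2)) - Real.log (a (i + 1)) with hd
  have hdmono : Monotone d := by
    refine monotone_nat_of_le_succ fun i => ?_
    have h1 := hposAll (i + 1)
    have h3 := hposAll (i + 3)
    have hlog := Real.log_le_log (pow_pos (hposAll (i + 2)) 2) (hconv i)
    rw [Real.log_pow, Real.log_mul h1.ne' h3.ne'] at hlog
    push_cast at hlog
    have e1 : d i = Real.log (a (i + 2)) - Real.log (a (i + 1)) := rfl
    have e2 : d (i + 1) = Real.log (a (i + 3)) - Real.log (a (i + 2)) := rfl
    rw [e1, e2]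
    linarith
  -- telescoping
  have htel : ∀ j, Real.log (a (j + 1)) - Real.log (a 1) = ∑ i ∈ Finset.range j, d i := by
    intro j
    rw [← Finset.sum_range_sub (fun i => Real.log (a (i + 1))) j]
  -- (1) the chord slope bounds the increment `d n'` from below
  have h1 : Real.log (a (n' + 2)) - Real.log (a 1) ≤ ((n' : ℝ) + 1) * d n' := by
    rw [htel (n' + 1)]
    have : ∑ i ∈ Finset.range (n' + 1), d i ≤ ∑ _i ∈ Finset.range (n' + 1), d n' :=
      Finset.sum_le_sum fun i hi =>
        hdmono (Nat.lt_succ_iff.mp (Finset.mem_range.mp hi))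
    simpa [Finset.sum_const, Finset.card_range] using this
  -- (2) beyond `n` the increments are at least `d n'`
  have h2 : ∀ j : ℕ, Real.log (a (n' + 2)) + j * d n' ≤ Real.log (a (n' + 2 + j)) := by
    intro j
    induction j with
    | zero => simp
    | succ j ih =>
      have hstep : d n' ≤ d (n' + 1 + j) := hdmono (by omega)
      have e : d (n' + 1 + j) = Real.log (a (n' + 2 + (j + 1))) - Real.log (a (n' + 2 + j)) := by
        show Real.log (a (n' + 1 + j + 2)) - Real.log (a (n' + 1 + j + 1)) = _
        rw [show n' + 1 + j + 2 = n' + 2 + (j + 1) by omega,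
          show n' + 1 + j + 1 = n' + 2 + j by omega]
      rw [e] at hstep
      push_cast
      linarith
  -- assemble
  have hn1 : ((n' + 2 : ℕ) : ℝ) - 1 = (n' : ℝ) + 1 := by push_cast; ring
  rw [hn1]
  set m := (Real.log (a 1) - Real.log (a (n' + 2))) / ((n' : ℝ) + 1) with hm
  have hn'pos : (0 : ℝ) < (n' : ℝ) + 1 := by positivity
  have hm0 : 0 ≤ m := by
    apply div_nonneg _ hn'pos.le
    have : a (n' + 2) ≤ a 1 := hanti (by omega)
    linarith [Real.log_le_log hpos this]
  have hdm : -m ≤ d n' := by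
    have : (Real.log (a (n' + 2)) - Real.log (a 1)) / ((n' : ℝ) + 1) ≤ d n' := by
      rw [div_le_iff₀ hn'pos]
      linarith [h1]
    calc -m = (Real.log (a (n' + 2)) - Real.log (a 1)) / ((n' : ℝ) + 1) := by rw [hm]; ring
      _ ≤ d n' := this
  refine ⟨hm0, fun k => ?_⟩
  rcases le_or_gt k (n' + 2) with hk | hk
  · -- `k ≤ n`: monotonicity
    have hak : a (n' + 2) ≤ a k := hanti hk
    have hexp : Real.exp (-(m * k)) ≤ 1 := by
      rw [Real.exp_le_one_iff]
      have : 0 ≤ m * k := mul_nonneg hm0 (Nat.cast_nonneg k)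
      linarith
    calc a (n' + 2) * Real.exp (-(m * k)) ≤ a (n' + 2) * 1 := by gcongr
      _ = a (n' + 2) := mul_one _
      _ ≤ a k := hak
  · -- `k > n`: the chord propagated by log-convexity
    obtain ⟨j, rfl⟩ : ∃ j, k = n' + 2 + j := ⟨k - (n' + 2), by omega⟩
    have hlog : Real.log (a (n' + 2)) - m * ((n' + 2 + j : ℕ) : ℝ) ≤
        Real.log (a (n' + 2 + j)) := by
      have hj := h2 j
      have hjm : (j : ℝ) * (-m) ≤ (j : ℝ) * d n' :=
        mul_le_mul_of_nonneg_left hdm (Nat.cast_nonneg j)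
      have hmn : 0 ≤ m * ((n' : ℝ) + 2) := mul_nonneg hm0 (by positivity)
      push_cast
      nlinarith [hj, hjm, hmn]
    calc a (n' + 2) * Real.exp (-(m * ((n' + 2 + j : ℕ) : ℝ)))
        = Real.exp (Real.log (a (n' + 2)) - m * ((n' + 2 + j : ℕ) : ℝ)) := by
          rw [Real.exp_sub, Real.exp_log hpos, div_eq_mul_inv, Real.exp_neg]
      _ ≤ Real.exp (Real.log (a (n' + 2 + j))) := Real.exp_le_exp.mpr hlog
      _ = a (n' + 2 + j) := Real.exp_log (hposAll _)

/-- For every `C`, every `ε > 0` and every `N₀` there is `n ≥ max N₀ 2` with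
`(C + 8 log n)/(n - 1) < ε` (because `log n / (n - 1) → 0`). -/
theorem exists_nat_chord_small (C ε : ℝ) (hε : 0 < ε) (N₀ : ℕ) :
    ∃ n : ℕ, N₀ ≤ n ∧ 2 ≤ n ∧ (C + 8 * Real.log n) / ((n : ℝ) - 1) < ε := by
  have hlog : Tendsto (fun x : ℝ => Real.log x ^ 1 / (1 * x + (-1))) atTop (𝓝 0) :=
    Real.tendsto_pow_log_div_mul_add_atTop 1 (-1) 1 one_ne_zero
  have hconst : Tendsto (fun x : ℝ => C / (x + (-1))) atTop (𝓝 0) :=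
    tendsto_const_nhds.div_atTop (tendsto_atTop_add_const_right _ _ tendsto_id)
  have hsum := hconst.add (hlog.const_mul 8)
  rw [mul_zero, add_zero] at hsum
  have h1 : Tendsto (fun x : ℝ => (C + 8 * Real.log x) / (x - 1)) atTop (𝓝 0) := by
    refine hsum.congr' (Eventually.of_forall fun x => ?_)
    simp only [pow_one, one_mul, ← sub_eq_add_neg]
    ring
  have h2 : Tendsto (fun n : ℕ => (C + 8 * Real.log n) / ((n : ℝ) - 1)) atTop (𝓝 0) :=
    h1.comp tendsto_natCast_atTop_atTop
  have h3 : ∀ᶠ n : ℕ in atTop, (C + 8 * Real.log n) / ((n : ℝ) - 1) < ε :=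
    (tendsto_order.1 h2).2 ε hε
  obtain ⟨n, hn⟩ := (h3.and (eventually_ge_atTop (max N₀ 2))).exists
  exact ⟨n, le_of_max_le_left hn.2, le_of_max_le_right hn.2, hn.1⟩

/-- **Item `stmt-QuantumFields-8943` (route DirichletWindow): the chord glue.**
`AxialLogConvexity → FixedDistanceLower → PlaquetteVarianceUpper → XiDiverges`: a fixed-distance
lower bound `f_β(n e₀) ≥ A/(β² n⁸)` and the variance bound `f_β(0) ≤ B/β²`, fed through the
reflection-positivity log-convexity of `n ↦ f_β(n e₀)`, give for every `ε > 0` and all large `β`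
an exponential lower bound `f_β(k e₀) ≥ A' e^{-m k}` with rate `m ≤ ε`, uniformly over
infinite-volume limit states (`ξ_lat(β) → ∞`). -/
theorem xiDivergesOfFixedDistance_proof :
    Summit.QuantumFields.YangMills.Theses.DirichletWindow.XiDivergesOfFixedDistance := by
  unfold Summit.QuantumFields.YangMills.Theses.DirichletWindow.XiDivergesOfFixedDistance
  intro hconv hlow hvar G _ _ _ _ _ _ hG r ε hε
  obtain ⟨A, n₀, hA, hlow⟩ := hlow G hG r
  obtain ⟨B, β₁, hvar⟩ := hvar G hG r
  obtain ⟨n, hn₀, hn2, hn⟩ :=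
    exists_nat_chord_small (Real.log (max B 1) - Real.log A) ε hε n₀
  obtain ⟨βn, hβn⟩ := hlow n hn₀
  refine ⟨max (max βn β₁) 1, fun β hβ μ hμ => ?_⟩
  have hββn : βn ≤ β := le_trans ((le_max_left _ _).trans (le_max_left _ _)) hβ
  have hββ₁ : β₁ ≤ β := le_trans ((le_max_right _ _).trans (le_max_left _ _)) hβ
  have hβ1 : 1 ≤ β := le_trans (le_max_right _ _) hβ
  have hβ0 : 0 < β := by linarith
  set a : ℕ → ℝ := fun k => Literature.MathematicalPhysics.QuantumLattice.plaquetteCorrFn r.ρ μ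
    ((k : ℤ) • Pi.single (0 : Fin 4) (1 : ℤ)) with ha
  have hax := hconv G hG r β hβ0.le μ hμ
  have hmono : ∀ k, a (k + 1) ≤ a k := fun k => (hax k).2.1
  have hlc : ∀ k, a (k + 2) ^ 2 ≤ a (k + 1) * a (k + 3) := fun k => (hax k).2.2.2
  have hlowβ : A / (β ^ 2 * (n : ℝ) ^ 8) ≤ a n := hβn β hββn μ hμ
  have hvarβ : a 0 ≤ B / β ^ 2 := by
    have := hvar β hββ₁ μ hμ
    simpa [ha] using this
  have hn0 : (0 : ℝ) < n := by exact_mod_cast (show 0 < n by omega)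
  have hApos : 0 < A / (β ^ 2 * (n : ℝ) ^ 8) := by positivity
  have hpos : 0 < a n := hApos.trans_le hlowβ
  obtain ⟨hm0, hchord⟩ := xiChord_exp_lower a n hn2 hmono hlc hpos
  refine ⟨(Real.log (a 1) - Real.log (a n)) / ((n : ℝ) - 1), a n, hpos, hm0, ?_, hchord⟩
  -- the slope is at most `ε`
  have hn1 : (0 : ℝ) < (n : ℝ) - 1 := by
    have : (2 : ℝ) ≤ n := by exact_mod_cast hn2
    linarith
  have hB' : (0 : ℝ) < max B 1 := lt_of_lt_of_le one_pos (le_max_right _ _)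
  have ha1pos : 0 < a 1 := by
    have := hchord 1
    have h' : 0 < a n * Real.exp (-((Real.log (a 1) - Real.log (a n)) / ((n : ℝ) - 1) * (1 : ℕ)))
      := mul_pos hpos (Real.exp_pos _)
    exact h'.trans_le this
  have hup : Real.log (a 1) ≤ Real.log (max B 1) - 2 * Real.log β := by
    have h01 : a 1 ≤ max B 1 / β ^ 2 := by
      calc a 1 ≤ a 0 := hmono 0
        _ ≤ B / β ^ 2 := hvarβ
        _ ≤ max B 1 / β ^ 2 := by gcongr; exact le_max_left _ _
    have := Real.log_le_log ha1pos h01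
    rw [Real.log_div hB'.ne' (by positivity), Real.log_pow] at this
    push_cast at this
    linarith
  have hdown : Real.log A - 2 * Real.log β - 8 * Real.log n ≤ Real.log (a n) := by
    have := Real.log_le_log hApos hlowβ
    rw [Real.log_div hA.ne' (by positivity), Real.log_mul (by positivity) (by positivity),
      Real.log_pow, Real.log_pow] at this
    push_cast at this
    linarith
  have hnum : Real.log (a 1) - Real.log (a n) ≤
      Real.log (max B 1) - Real.log A + 8 * Real.log n := by linarith
  exact le_of_lt (lt_of_le_of_lt (div_le_div_of_nonneg_right hnum hn1.le) hn)

end Summit.QuantumFields.YangMills.Theorems
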